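import Summits.QuantumFields.YangMills.Theorems.BalabanUVNodesN16Eq42PermutationDefect
import Summits.QuantumFields.BalabanUV.Gaps.D4WalkBlockExpWindow
import HarnessLib

/-!
# YM-DAG node N16 (NE3), the located averaging pin (42) ↔ (0.4) — THE PERMUTATION DEFECT OF (42), part 3: THE NON-ABELIAN
# AVERAGE TO FIRST ORDER — the relabelling defect of the exponent `X_c` and of `V̄_c` itself is [Lipschitz-flux term] + [second order
# in the local potential]; at constant curvature it is SECOND ORDER

Cell `pub-ymgap`, width seat `pub-ymgap-dag-n16-w3` (director-ym №197 ∕ HUMAN RULING D-0149), generation 2; part 3 of the W1b sequel over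
part 1 `BalabanUVNodesN16Eq42PermutationDefect` (linearised level).  `--kind proof --supports stmt-QuantumFields-20544 --as helper`
(K3⁷; count-neutral).  `bears_on: R4∕N16`.

THE POINT.  Parts 1–2 quantified the Euclidean (axis-relabelling) defect of (42) at the LINEARISED level (`X̂_c`, any normed ring) and
for the ABELIAN average.  The tree's NE3 objects are NON-abelian (`U(N)`-valued configurations in `M_N(ℂ)`).  Here, in ANY complete
normed `ℂ`-algebra with `‖1‖ = 1` (so `M_N(ℂ)`), for a configuration written near the block as `V_b = e^{A_b}`, `‖A_b‖ ≤ a` (a local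
gauge; [Balaban1985Averaging] p. 25 «hence `V₀,b = e^{iA_b}`», tree `B7Prop1Explicit.walk_linear`), the exponent `X_c` of (42)
(tree `Xavg`) is its linearisation `X̂_c` up to the universal second-order remainder
`ρ₂(ℓ, a) := ρ(2(e^{ℓa} − 1)) + ρ(ℓa)`, `ρ(t) = e^t − 1 − t`, `ℓ = 2dL + 2L` the longest loop of (42) (§1–§2:
`norm_mlog_hol_sub_asum_le`, `norm_Xavg_sub_Xhat_le`; tree `walk_linear` + `norm_mlog_sub_le`).  Hence (§3) the RELABELLING DEFECT OF THE
NON-ABELIAN EXPONENT: `‖X[r_σV](q,κ) − X[V](r_σq, σκ)‖ ≤ d(d+2)L³·δ + 2ρ₂(ℓ,a)` for `δ`-Lipschitz circulations of `A`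
(`norm_Xavg_permCfg_sub_le`, part 1's `norm_Xhat_permCfg_sub_le` in the middle), and `≤ 2ρ₂(ℓ,a)` — SECOND ORDER ONLY — when the
circulations of `A` are constant (`norm_Xavg_permCfg_sub_le_of_const_flux`); and (§4) for (42) itself, `V̄ = e^{X}·V(Γ_c)` with the
straight transporter relabelled to the straight transporter and of norm `≤ 1` on `U1`-valued fields:
`‖V̄[r_σV](q,κ) − (r_σV̄[V])(q,κ)‖ ≤ e·(d(d+2)L³δ + 2ρ₂(ℓ,a))` (`norm_bavg_permCfg_sub_le`; the exponential is `e`-Lipschitz on the ball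
`‖X‖ ≤ 1`, `D4WalkBlockExpWindow.norm_exp_sub_exp_le`, and `‖X_c‖ ≤ 2(e^{ℓa} − 1) ≤ 1`).

READING FOR N16 (honest; no theorem about minimisers here).  In an axial-type gauge about the block a configuration with plaquettes
`|V(∂p) − 1| ≤ α₀` has `a = O(dL·α₀)` ([B7] p. 25, tree `axial_bond_bound`), so `ρ₂ = O((dL)⁴α₀²)`: on a level-`j` field of
[B11]-Thm-1 TYPE regularity (`α₀ = bη²`, flux Lipschitz constant `δ = cη³`, `η = L^{−j}`) the relabelling defect of the NON-ABELIAN (42)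
per coarse bond is `O(d²L³·c·η³ + d⁴L⁴·b²·η⁴)` against its own first-order term `X̂ = O(dL²·b·η²)`: a LATTICE ARTEFACT vanishing at
the continuum scale, one power of `η` below the average's leading deviation.  This quantifies the located pin (p584628) at first order
for the tree's actual (non-abelian) objects; it does NOT prove the (42) ↔ (0.4) transfer (different constraint manifolds).

HONEST FRAMING.  [folklore] bookkeeping over `B7Prop1Explicit` (`walk_linear`, `norm_mlog_sub_le`, `MatrixLog.norm_mlog_le_two_mul`,
`hol_permCfg`), part 1, and `Gaps/D4WalkBlockExpWindow.norm_exp_sub_exp_le` BY NAME; 0 `def`, 0 `sorry`; the local-gauge representation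
`V_b = e^{A_b}` is a HYPOTHESIS (inhabited: `V := exp ∘ A` bondwise for any bounded `A`); no printed sentence is a hypothesis; nothing of
[Balaban1985Averaging] ∕ [Balaban1987RG1] asserted beyond what the tree proves; no minimiser, no variational problem; `stub_h7` NOT closed;
N16 ∕ NE3 NOT discharged; count-neutral (typed 28∕28 · discharged 5∕27 unmoved).  One finite four-torus programme at fixed `ε` — the
Yang–Mills mass gap (Clay) is NOT proved by any of this; R4 closes the conditional finite-𝕋⁴ rung `BalabanLadder.UV` only; nothing
continuum ∕ ℝ⁴ ∕ OS.
-/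

set_option autoImplicit false

open scoped BigOperators
open NormedSpace Finset

namespace Summit.QuantumFields.YangMills.BalabanUVNodes.N16Eq42PermutationDefectNonAbelian

open Literature.MathematicalPhysics.QuantumFieldTheory.Balaban1983to89
open B7Prop1Explicit
open B12Average012Permutation (permSite permCfg permCfg_apply permSite_sub hol_permCfg map_seg)
open Summit.QuantumFields.YangMills.BalabanUVNodes.N16Eq42PermutationDefect

noncomputable section

variable {d : ℕ}
variable {𝔸 : Type*} [NormedRing 𝔸] [NormOneClass 𝔸] [NormedAlgebra ℂ 𝔸] [CompleteSpace 𝔸]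

/-! ## §1 The logarithm of a parallel transporter to second order -/

omit [NormOneClass 𝔸] in
/-- **`log V(Γ) = A(Γ) + O((|Γ|a)²)`**: along a word `Γ` of length `n` inside the region where `V_b = e^{A_b}`, `‖A_b‖ ≤ a`, with
`e^{na} − 1 ≤ ½` (so `V(Γ)` is in the ball of the logarithm), `‖log V(Γ) − A(Γ)‖ ≤ ρ(2(e^{na} − 1)) + ρ(na)`
(tree `walk_linear`: `‖V(Γ) − 1 − A(Γ)‖ ≤ ρ(na)`, `‖V(Γ) − 1‖ ≤ e^{na} − 1`; tree `norm_mlog_sub_le`: `‖log W − (W − 1)‖ ≤ ρ(2‖W − 1‖)`).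
[cite: Balaban1985Averaging, (26)–(27) p.21, p.25] -/
theorem norm_mlog_hol_sub_asum_le (V : Site d → Fin d → 𝔸ˣ) (A : Site d → Fin d → 𝔸) (y : Site d) (R : ℕ) {a : ℝ}
    (ha : 0 ≤ a) (hVA : ∀ (x : Site d) (κ : Fin d), l1 (x - y) ≤ R → ((V x κ : 𝔸ˣ) : 𝔸) = exp (A x κ) ∧ ‖A x κ‖ ≤ a)
    (w : List (Letter d)) (x : Site d) (hx : l1 (x - y) + w.length ≤ R) (hsmall : Real.exp (w.length * a) - 1 ≤ 1 / 2) :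
    ‖MatrixLog.mlog ((hol V x w : 𝔸ˣ) : 𝔸) - asum A x w‖
      ≤ expRem (2 * (Real.exp (w.length * a) - 1)) + expRem (w.length * a) := by
  obtain ⟨h1, h2⟩ := walk_linear V A y R ha hVA w x hx
  have hW : ‖((hol V x w : 𝔸ˣ) : 𝔸) - 1‖ ≤ 1 / 2 := h1.trans hsmall
  have hlog := norm_mlog_sub_le hW
  calc ‖MatrixLog.mlog ((hol V x w : 𝔸ˣ) : 𝔸) - asum A x w‖
      = ‖(MatrixLog.mlog ((hol V x w : 𝔸ˣ) : 𝔸) - (((hol V x w : 𝔸ˣ) : 𝔸) - 1))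
          + ((((hol V x w : 𝔸ˣ) : 𝔸) - 1) - asum A x w)‖ := by rw [sub_add_sub_cancel]
    _ ≤ ‖MatrixLog.mlog ((hol V x w : 𝔸ˣ) : 𝔸) - (((hol V x w : 𝔸ˣ) : 𝔸) - 1)‖
          + ‖(((hol V x w : 𝔸ˣ) : 𝔸) - 1) - asum A x w‖ := norm_add_le _ _
    _ ≤ expRem (2 * ‖((hol V x w : 𝔸ˣ) : 𝔸) - 1‖) + expRem (w.length * a) := add_le_add hlog h2
    _ ≤ expRem (2 * (Real.exp (w.length * a) - 1)) + expRem (w.length * a) := by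
        have hmono : expRem (2 * ‖((hol V x w : 𝔸ˣ) : 𝔸) - 1‖) ≤ expRem (2 * (Real.exp (w.length * a) - 1)) :=
          expRem_mono (by positivity) (by linarith)
        exact add_le_add hmono le_rfl

/-! ## §2 The exponent of (42) against its linearisation -/

omit [NormOneClass 𝔸] in
/-- The loops of (42) at a `κ`-bond have length `≤ ℓ := 2dL + 2L`. [folklore] -/
theorem length_loop_le (L : ℕ) (κ : Fin d) (r : Fin d → Fin L) :
    (gammaWord L κ (boxVec L r) ++ seg κ (-(L : ℤ))).length ≤ 2 * (d * L) + L + L := by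
  rw [List.length_append, length_gammaWord, length_seg]
  have := l1_boxVec_le L r
  simp only [Int.natAbs_neg, Int.natAbs_natCast]
  nlinarith

omit [NormOneClass 𝔸] in
/-- **`X_c = X̂_c + O((ℓa)²)`**: for a configuration written as `V_b = e^{A_b}`, `‖A_b‖ ≤ a`, on the bonds within `|·|₁`-distance
`ℓ = 2dL + 2L` of `c₋ = q`, with `e^{ℓa} − 1 ≤ ½`, the exponent of (42) (tree `Xavg`, the block mean of the loop logarithms) is within
`ρ₂(ℓ,a) = ρ(2(e^{ℓa} − 1)) + ρ(ℓa)` of its linearisation `X̂_c` (tree `Xhat`, the block mean of the loop circulations of `A`).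
[cite: Balaban1985Averaging, (42) p.23, p.25 (displays before (47))] -/
theorem norm_Xavg_sub_Xhat_le (L : ℕ) (hL : 1 ≤ L) (V : Site d → Fin d → 𝔸ˣ) (A : Site d → Fin d → 𝔸) (q : Site d) (κ : Fin d)
    {a : ℝ} (ha : 0 ≤ a)
    (hVA : ∀ (x : Site d) (μ : Fin d), l1 (x - q) ≤ 2 * (d * L) + L + L → ((V x μ : 𝔸ˣ) : 𝔸) = exp (A x μ) ∧ ‖A x μ‖ ≤ a)
    (hsmall : Real.exp (((2 * (d * L) + L + L : ℕ) : ℝ) * a) - 1 ≤ 1 / 2) :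
    ‖Xavg L V q κ - Xhat L A q κ‖
      ≤ expRem (2 * (Real.exp (((2 * (d * L) + L + L : ℕ) : ℝ) * a) - 1)) + expRem (((2 * (d * L) + L + L : ℕ) : ℝ) * a) := by
  set ℓ : ℕ := 2 * (d * L) + L + L with hℓ
  set B : ℝ := expRem (2 * (Real.exp ((ℓ : ℝ) * a) - 1)) + expRem ((ℓ : ℝ) * a) with hB
  have hL0 : (0 : ℝ) < (L : ℝ) ^ d := pow_pos (by exact_mod_cast (by omega : 0 < L)) _
  have hterm : ∀ r : Fin d → Fin L,
      ‖MatrixLog.mlog ((Wcx L V q κ (boxVec L r) : 𝔸ˣ) : 𝔸) - asum A q (gammaWord L κ (boxVec L r) ++ seg κ (-(L : ℤ)))‖ ≤ B := by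
    intro r
    set w := gammaWord L κ (boxVec L r) ++ seg κ (-(L : ℤ)) with hw
    have hlen : w.length ≤ ℓ := length_loop_le L κ r
    have hna : (w.length : ℝ) * a ≤ (ℓ : ℝ) * a := mul_le_mul_of_nonneg_right (by exact_mod_cast hlen) ha
    have hexp : Real.exp (w.length * a) - 1 ≤ Real.exp ((ℓ : ℝ) * a) - 1 := by linarith [Real.exp_le_exp.mpr hna]
    have h := norm_mlog_hol_sub_asum_le V A q ℓ ha hVA w q (by simp [l1]; exact hlen) (hexp.trans hsmall)
    rw [Wcx_eq_hol_loop]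
    refine h.trans (add_le_add (expRem_mono (by
        have := Real.one_le_exp (by positivity : (0 : ℝ) ≤ w.length * a); positivity) (by linarith))
      (expRem_mono (by positivity) hna))
  unfold Xavg Xhat
  rw [← Finset.sum_sub_distrib]
  calc ‖∑ r : Fin d → Fin L, ((((L : ℝ) ^ d)⁻¹) • MatrixLog.mlog ((Wcx L V q κ (boxVec L r) : 𝔸ˣ) : 𝔸)
          - (((L : ℝ) ^ d)⁻¹) • asum A q (gammaWord L κ (boxVec L r) ++ seg κ (-(L : ℤ))))‖
      ≤ ∑ r : Fin d → Fin L, ‖(((L : ℝ) ^ d)⁻¹) • MatrixLog.mlog ((Wcx L V q κ (boxVec L r) : 𝔸ˣ) : 𝔸)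
          - (((L : ℝ) ^ d)⁻¹) • asum A q (gammaWord L κ (boxVec L r) ++ seg κ (-(L : ℤ)))‖ := norm_sum_le _ _
    _ ≤ ∑ _r : Fin d → Fin L, ((L : ℝ) ^ d)⁻¹ * B := Finset.sum_le_sum fun r _ => by
        rw [← smul_sub, norm_smul, norm_inv, Real.norm_of_nonneg hL0.le]
        exact mul_le_mul_of_nonneg_left (hterm r) (by positivity)
    _ = B := by
        rw [Finset.sum_const, Finset.card_univ, Fintype.card_fun, Fintype.card_fin, Fintype.card_fin, nsmul_eq_mul]
        push_cast
        field_simp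

omit [NormOneClass 𝔸] in
/-- The exponent of (42) is small: `‖X_c‖ ≤ 2(e^{ℓa} − 1)` under the same hypotheses (`|log W| ≤ 2|W − 1|`, tree
`MatrixLog.norm_mlog_le_two_mul`, and `walk_linear`). [cite: Balaban1985Averaging, (26) p.21] -/
theorem norm_Xavg_le (L : ℕ) (hL : 1 ≤ L) (V : Site d → Fin d → 𝔸ˣ) (A : Site d → Fin d → 𝔸) (q : Site d) (κ : Fin d)
    {a : ℝ} (ha : 0 ≤ a)
    (hVA : ∀ (x : Site d) (μ : Fin d), l1 (x - q) ≤ 2 * (d * L) + L + L → ((V x μ : 𝔸ˣ) : 𝔸) = exp (A x μ) ∧ ‖A x μ‖ ≤ a)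
    (hsmall : Real.exp (((2 * (d * L) + L + L : ℕ) : ℝ) * a) - 1 ≤ 1 / 2) :
    ‖Xavg L V q κ‖ ≤ 2 * (Real.exp (((2 * (d * L) + L + L : ℕ) : ℝ) * a) - 1) := by
  set ℓ : ℕ := 2 * (d * L) + L + L with hℓ
  have hL0 : (0 : ℝ) < (L : ℝ) ^ d := pow_pos (by exact_mod_cast (by omega : 0 < L)) _
  have hterm : ∀ r : Fin d → Fin L,
      ‖MatrixLog.mlog ((Wcx L V q κ (boxVec L r) : 𝔸ˣ) : 𝔸)‖ ≤ 2 * (Real.exp ((ℓ : ℝ) * a) - 1) := by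
    intro r
    set w := gammaWord L κ (boxVec L r) ++ seg κ (-(L : ℤ)) with hw
    have hlen : w.length ≤ ℓ := length_loop_le L κ r
    have hna : (w.length : ℝ) * a ≤ (ℓ : ℝ) * a := mul_le_mul_of_nonneg_right (by exact_mod_cast hlen) ha
    have hexp : Real.exp (w.length * a) - 1 ≤ Real.exp ((ℓ : ℝ) * a) - 1 := by linarith [Real.exp_le_exp.mpr hna]
    have h1 := (walk_linear V A q ℓ ha hVA w q (by simp [l1]; exact hlen)).1
    rw [Wcx_eq_hol_loop]
    have hW : ‖((hol V q w : 𝔸ˣ) : 𝔸) - 1‖ ≤ 1 / 2 := h1.trans (hexp.trans hsmall)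
    exact (MatrixLog.norm_mlog_le_two_mul hW).trans (by linarith)
  unfold Xavg
  calc ‖∑ r : Fin d → Fin L, (((L : ℝ) ^ d)⁻¹) • MatrixLog.mlog ((Wcx L V q κ (boxVec L r) : 𝔸ˣ) : 𝔸)‖
      ≤ ∑ r : Fin d → Fin L, ‖(((L : ℝ) ^ d)⁻¹) • MatrixLog.mlog ((Wcx L V q κ (boxVec L r) : 𝔸ˣ) : 𝔸)‖ := norm_sum_le _ _
    _ ≤ ∑ _r : Fin d → Fin L, ((L : ℝ) ^ d)⁻¹ * (2 * (Real.exp ((ℓ : ℝ) * a) - 1)) := Finset.sum_le_sum fun r _ => by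
        rw [norm_smul, norm_inv, Real.norm_of_nonneg hL0.le]
        exact mul_le_mul_of_nonneg_left (hterm r) (by positivity)
    _ = 2 * (Real.exp ((ℓ : ℝ) * a) - 1) := by
        rw [Finset.sum_const, Finset.card_univ, Fintype.card_fun, Fintype.card_fin, Fintype.card_fin, nsmul_eq_mul]
        push_cast
        field_simp

/-! ## §3 The relabelling defect of the non-abelian exponent -/

omit [NormOneClass 𝔸] [NormedAlgebra ℂ 𝔸] [CompleteSpace 𝔸] in
/-- The local-gauge representation is inherited by the relabelled configuration about the relabelled point: `(r_σV)_b = e^{(r_σA)_b}`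
on `|x − q|₁ ≤ R` iff the same for `V, A` on `|x − r_σq|₁ ≤ R`. [folklore] -/
theorem expRep_permCfg (σ : Equiv.Perm (Fin d)) (V : Site d → Fin d → 𝔸ˣ) (A : Site d → Fin d → 𝔸) (q : Site d) (R : ℕ)
    {a : ℝ}
    (hVA : ∀ (x : Site d) (μ : Fin d), l1 (x - permSite σ q) ≤ R → ((V x μ : 𝔸ˣ) : 𝔸) = exp (A x μ) ∧ ‖A x μ‖ ≤ a)
    (x : Site d) (μ : Fin d) (hx : l1 (x - q) ≤ R) :
    ((permCfg σ V x μ : 𝔸ˣ) : 𝔸) = exp (permCfg σ A x μ) ∧ ‖permCfg σ A x μ‖ ≤ a := by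
  have hl : l1 (permSite σ x - permSite σ q) ≤ R := by rwa [← permSite_sub, l1_permSite]
  exact hVA (permSite σ x) (σ μ) hl

omit [NormOneClass 𝔸] in
/-- **★ THE RELABELLING DEFECT OF THE NON-ABELIAN EXPONENT OF (42)**: `‖X[r_σV](q,κ) − X[V](r_σq, σκ)‖ ≤ d(d+2)L³·δ + 2ρ₂(ℓ,a)` —
part 1's Lipschitz-flux bound for the linearisation in the middle, §2 on both sides (the relabelled configuration is `e^{r_σA}` about
`q`). Hypotheses: `V_b = e^{A_b}`, `‖A_b‖ ≤ a` within `|·|₁`-distance `ℓ` of `q′ = r_σq`, `e^{ℓa} − 1 ≤ ½`, and circulations of `A` in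
the planes `(m, σκ)` `δ`-Lipschitz in the base point within `(d+2)L` of `q′`. [folklore] -/
theorem norm_Xavg_permCfg_sub_le (L : ℕ) (hL : 1 ≤ L) (σ : Equiv.Perm (Fin d)) (V : Site d → Fin d → 𝔸ˣ)
    (A : Site d → Fin d → 𝔸) (q : Site d) (κ : Fin d) {a : ℝ} (ha : 0 ≤ a)
    (hVA : ∀ (x : Site d) (μ : Fin d), l1 (x - permSite σ q) ≤ 2 * (d * L) + L + L →
      ((V x μ : 𝔸ˣ) : 𝔸) = exp (A x μ) ∧ ‖A x μ‖ ≤ a)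
    (hsmall : Real.exp (((2 * (d * L) + L + L : ℕ) : ℝ) * a) - 1 ≤ 1 / 2) {δ : ℝ} (hδ0 : 0 ≤ δ)
    (hδ : ∀ (p : Site d) (m : Fin d), l1 (p - permSite σ q) ≤ (d + 2) * L →
      ‖asum A p (plaqWord m (σ κ)) - asum A (permSite σ q) (plaqWord m (σ κ))‖ ≤ δ * l1 (p - permSite σ q)) :
    ‖Xavg L (permCfg σ V) q κ - Xavg L V (permSite σ q) (σ κ)‖
      ≤ d * (d + 2) * (L : ℝ) ^ 3 * δ
        + 2 * (expRem (2 * (Real.exp (((2 * (d * L) + L + L : ℕ) : ℝ) * a) - 1))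
            + expRem (((2 * (d * L) + L + L : ℕ) : ℝ) * a)) := by
  have h1 := norm_Xavg_sub_Xhat_le L hL (permCfg σ V) (permCfg σ A) q κ ha (expRep_permCfg σ V A q _ hVA) hsmall
  have h2 := norm_Xavg_sub_Xhat_le L hL V A (permSite σ q) (σ κ) ha hVA hsmall
  have h3 := norm_Xhat_permCfg_sub_le L hL σ A q κ hδ0 hδ
  calc ‖Xavg L (permCfg σ V) q κ - Xavg L V (permSite σ q) (σ κ)‖
      = ‖(Xavg L (permCfg σ V) q κ - Xhat L (permCfg σ A) q κ)
          + (Xhat L (permCfg σ A) q κ - Xhat L A (permSite σ q) (σ κ))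
          - (Xavg L V (permSite σ q) (σ κ) - Xhat L A (permSite σ q) (σ κ))‖ := by congr 1; abel
    _ ≤ ‖Xavg L (permCfg σ V) q κ - Xhat L (permCfg σ A) q κ‖
          + ‖Xhat L (permCfg σ A) q κ - Xhat L A (permSite σ q) (σ κ)‖
          + ‖Xavg L V (permSite σ q) (σ κ) - Xhat L A (permSite σ q) (σ κ)‖ :=
        (norm_sub_le _ _).trans (add_le_add (norm_add_le _ _) le_rfl)
    _ ≤ _ := by linarith

omit [NormOneClass 𝔸] in
/-- **★ AT CONSTANT CURVATURE THE NON-ABELIAN DEFECT IS SECOND ORDER**: if the circulations of `A` in the planes `(m, σκ)` do not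
depend on the base point, `‖X[r_σV](q,κ) − X[V](r_σq, σκ)‖ ≤ 2ρ₂(ℓ,a)` (part 1's `Xhat_permCfg_of_const_flux`: the linearised defect
vanishes). [folklore] -/
theorem norm_Xavg_permCfg_sub_le_of_const_flux (L : ℕ) (hL : 1 ≤ L) (σ : Equiv.Perm (Fin d)) (V : Site d → Fin d → 𝔸ˣ)
    (A : Site d → Fin d → 𝔸) (q : Site d) (κ : Fin d) {a : ℝ} (ha : 0 ≤ a)
    (hVA : ∀ (x : Site d) (μ : Fin d), l1 (x - permSite σ q) ≤ 2 * (d * L) + L + L →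
      ((V x μ : 𝔸ˣ) : 𝔸) = exp (A x μ) ∧ ‖A x μ‖ ≤ a)
    (hsmall : Real.exp (((2 * (d * L) + L + L : ℕ) : ℝ) * a) - 1 ≤ 1 / 2)
    (f : Fin d → 𝔸) (hf : ∀ (p : Site d) (m : Fin d), asum A p (plaqWord m (σ κ)) = f m) :
    ‖Xavg L (permCfg σ V) q κ - Xavg L V (permSite σ q) (σ κ)‖
      ≤ 2 * (expRem (2 * (Real.exp (((2 * (d * L) + L + L : ℕ) : ℝ) * a) - 1))
            + expRem (((2 * (d * L) + L + L : ℕ) : ℝ) * a)) := by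
  have h1 := norm_Xavg_sub_Xhat_le L hL (permCfg σ V) (permCfg σ A) q κ ha (expRep_permCfg σ V A q _ hVA) hsmall
  have h2 := norm_Xavg_sub_Xhat_le L hL V A (permSite σ q) (σ κ) ha hVA hsmall
  have h3 : Xhat L (permCfg σ A) q κ = Xhat L A (permSite σ q) (σ κ) := Xhat_permCfg_of_const_flux L hL σ A q κ f hf
  calc ‖Xavg L (permCfg σ V) q κ - Xavg L V (permSite σ q) (σ κ)‖
      = ‖(Xavg L (permCfg σ V) q κ - Xhat L (permCfg σ A) q κ)
          - (Xavg L V (permSite σ q) (σ κ) - Xhat L A (permSite σ q) (σ κ))‖ := by rw [h3]; congr 1; abel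
    _ ≤ ‖Xavg L (permCfg σ V) q κ - Xhat L (permCfg σ A) q κ‖
          + ‖Xavg L V (permSite σ q) (σ κ) - Xhat L A (permSite σ q) (σ κ)‖ := norm_sub_le _ _
    _ ≤ _ := by linarith

/-! ## §4 The relabelling defect of the non-abelian average (42) itself -/

/-- **★★ THE RELABELLING DEFECT OF THE NON-ABELIAN BLOCK AVERAGE (42)**: `V̄_c = e^{X_c}·V(Γ_c)` (tree `bavg`); the straight
transporter of the relabelled field at `(q, κ)` IS the straight transporter of the field at `(r_σq, σκ)` (`hol_permCfg`, `map_seg`) and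
has norm `≤ 1` for a `U1`-valued field; the exponents are within `d(d+2)L³δ + 2ρ₂(ℓ,a)` (§3) and of norm `≤ 2(e^{ℓa} − 1) ≤ 1`, where the
exponential is `e`-Lipschitz (`D4WalkBlockExpWindow.norm_exp_sub_exp_le`).  Hence
`‖V̄[r_σV](q,κ) − (r_σV̄[V])(q,κ)‖ ≤ e·(d(d+2)L³·δ + 2ρ₂(ℓ,a))`. [folklore] -/
theorem norm_bavg_permCfg_sub_le (L : ℕ) (hL : 1 ≤ L) (σ : Equiv.Perm (Fin d)) (V : Site d → Fin d → 𝔸ˣ)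
    (hV : ∀ (x : Site d) (μ : Fin d), V x μ ∈ U1 𝔸)
    (A : Site d → Fin d → 𝔸) (q : Site d) (κ : Fin d) {a : ℝ} (ha : 0 ≤ a)
    (hVA : ∀ (x : Site d) (μ : Fin d), l1 (x - permSite σ q) ≤ 2 * (d * L) + L + L →
      ((V x μ : 𝔸ˣ) : 𝔸) = exp (A x μ) ∧ ‖A x μ‖ ≤ a)
    (hsmall : Real.exp (((2 * (d * L) + L + L : ℕ) : ℝ) * a) - 1 ≤ 1 / 2) {δ : ℝ} (hδ0 : 0 ≤ δ)
    (hδ : ∀ (p : Site d) (m : Fin d), l1 (p - permSite σ q) ≤ (d + 2) * L →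
      ‖asum A p (plaqWord m (σ κ)) - asum A (permSite σ q) (plaqWord m (σ κ))‖ ≤ δ * l1 (p - permSite σ q)) :
    ‖((bavg L (permCfg σ V) q κ : 𝔸ˣ) : 𝔸) - ((permCfg σ (bavg L V) q κ : 𝔸ˣ) : 𝔸)‖
      ≤ Real.exp 1 * (d * (d + 2) * (L : ℝ) ^ 3 * δ
        + 2 * (expRem (2 * (Real.exp (((2 * (d * L) + L + L : ℕ) : ℝ) * a) - 1))
            + expRem (((2 * (d * L) + L + L : ℕ) : ℝ) * a))) := by
  -- the two exponents and their common straight transporter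
  set X₁ := Xavg L (permCfg σ V) q κ with hX₁
  set X₂ := Xavg L V (permSite σ q) (σ κ) with hX₂
  have hh : hol (permCfg σ V) q (seg κ L) = hol V (permSite σ q) (seg (σ κ) L) := by
    rw [hol_permCfg, map_seg]
  have hnorm_h : ‖((hol V (permSite σ q) (seg (σ κ) L) : 𝔸ˣ) : 𝔸)‖ ≤ 1 := (mem_U1.mp (hol_mem hV _ _)).1
  have hb₁ : ((bavg L (permCfg σ V) q κ : 𝔸ˣ) : 𝔸) = exp X₁ * ((hol V (permSite σ q) (seg (σ κ) L) : 𝔸ˣ) : 𝔸) := by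
    rw [show bavg L (permCfg σ V) q κ = expUnit X₁ * hol (permCfg σ V) q (seg κ L) from rfl, hh, Units.val_mul, val_expUnit]
  have hb₂ : ((permCfg σ (bavg L V) q κ : 𝔸ˣ) : 𝔸) = exp X₂ * ((hol V (permSite σ q) (seg (σ κ) L) : 𝔸ˣ) : 𝔸) := by
    rw [permCfg_apply, show bavg L V (permSite σ q) (σ κ) = expUnit X₂ * hol V (permSite σ q) (seg (σ κ) L) from rfl,
      Units.val_mul, val_expUnit]
  -- norms of the exponents ≤ 1, so `exp` is `e`-Lipschitz there
  have hea : Real.exp (((2 * (d * L) + L + L : ℕ) : ℝ) * a) - 1 ≤ 1 / 2 := hsmall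
  have hX₁le : ‖X₁‖ ≤ 1 :=
    (norm_Xavg_le L hL (permCfg σ V) (permCfg σ A) q κ ha (expRep_permCfg σ V A q _ hVA) hsmall).trans (by linarith)
  have hX₂le : ‖X₂‖ ≤ 1 := (norm_Xavg_le L hL V A (permSite σ q) (σ κ) ha hVA hsmall).trans (by linarith)
  have hexp := Summit.QuantumFields.BalabanUV.Gaps.D4WalkBlockExpWindow.norm_exp_sub_exp_le X₁ X₂ hX₁le hX₂le
  have hdef := norm_Xavg_permCfg_sub_le L hL σ V A q κ ha hVA hsmall hδ0 hδ
  rw [hb₁, hb₂, ← sub_mul]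
  calc ‖(exp X₁ - exp X₂) * ((hol V (permSite σ q) (seg (σ κ) L) : 𝔸ˣ) : 𝔸)‖
      ≤ ‖exp X₁ - exp X₂‖ * ‖((hol V (permSite σ q) (seg (σ κ) L) : 𝔸ˣ) : 𝔸)‖ := norm_mul_le _ _
    _ ≤ ‖exp X₁ - exp X₂‖ * 1 := mul_le_mul_of_nonneg_left hnorm_h (norm_nonneg _)
    _ ≤ ‖X₁ - X₂‖ * Real.exp 1 := by rw [mul_one]; exact hexp
    _ ≤ _ := by rw [mul_comm]; exact mul_le_mul_of_nonneg_left hdef (Real.exp_pos 1).le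

end

end Summit.QuantumFields.YangMills.BalabanUVNodes.N16Eq42PermutationDefectNonAbelian
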